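import Literature.Geometry.Lorentzian.LocalIsometryJetRigidity
import Literature.Geometry.Lorentzian.ChartCalculus
import Mathlib.Analysis.ODE.Gronwall
import HarnessLib

/-!
# Killing fields are determined by their 1-jet at a point: the analysis in a chart
# (O'Neill 1983, Ch. 9, Lemma 9.28; Kobayashi–Nomizu I, Ch. VI, Thm. 3.3)

O'Neill, *Semi-Riemannian Geometry* (1983), Ch. 9, Lemma 9.28 and its proof: the evaluation
`X ↦ (X_p, (∇X)_p)` is injective on the Lie algebra of Killing fields of a connected
semi-Riemannian manifold (whence `dim ≤ n(n+1)/2`); Kobayashi–Nomizu, *Foundations of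
Differential Geometry* I (1963), Ch. VI, Thm. 3.3 (an infinitesimal isometry with vanishing
1-jet at a point vanishes identically); Wald, *General Relativity* (1984), App. C.3, (C.3.6)–(C.3.9)
("a Killing field is completely determined by the values of `ξ^a` and `∇_a ξ_b` at any point").
The tree's manifold version `IsKillingField.eq_zero_of_oneJet_eq_zero`
(`KillingAlgebraAsymptoticallyFlatProofs.lean`) goes through the global flow and needs the Killing
field to be COMPLETE. This file proves the **chart-level statement without any completeness or
flow**, by the prolongation/ODE argument of `LocalIsometryJetRigidity.lean` run on the LINEAR
coordinate Killing equation `𝓛_X G = DG(X)(·,·) + G(DX ·,·) + G(·, DX ·) = 0`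
(`KerrKillingTangency.lean`, `Kerr.killing_coord_lie_eq_zero`; O'Neill 1983, Ch. 9, Prop. 9.25):

* `KillingJetRigidity.two_mul_apply_fderiv_fderiv` — **the braid (Koszul) identity**: for a `C²`
  solution `X` of `𝓛_X G = 0` on an open set `s` (with `G` a `C²` field of symmetric forms),
  `2 G_x(D²X_x(z, u), w) = -(T(z; u, w) + T(u; z, w) - T(w; z, u))` where
  `T(z; u, w) = D²G_x(z, X x)(u, w) + DG_x(DX_x z)(u, w) + DG_x(z)(DX_x u, w) + DG_x(z)(u, DX_x w)`
  (differentiate the equation along `z` and solve for the symmetric `D²X` — Wald (C.3.6) in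
  coordinates); `two_mul_apply_fderiv_fderiv_of_apply_eq_zero` — at a ZERO of `X` the `D²G` term
  drops out, so `D²X_x` is an explicit bilinear expression in `DX_x` and `DG_x` alone (the input of
  the pointwise linear algebra classifying the Killing fields of a given metric);
* `KillingJetRigidity.exists_norm_fderiv_fderiv_le` — prolongation bound: near every point of `s`
  at which `G` is nondegenerate, `‖D²X_x‖ ≤ C (‖X x‖ + ‖DX_x‖)`;
* `KillingJetRigidity.eventually_eq_zero_of_oneJet_eq_zero` — if `X x₀ = 0`, `DX_{x₀} = 0` then
  `X = 0` and `DX = 0` near `x₀` (Grönwall along segments: the 1-jet solves a linear ODE);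
* **`KillingJetRigidity.eqOn_zero_of_isPreconnected`** — on a preconnected open `s` on which `G`
  is nondegenerate, a `C²` solution of `𝓛_X G = 0` with vanishing 1-jet at one point of `s`
  vanishes on `s` together with its derivative (open–closed argument).

Everything is Mathlib-only calculus; no definitions of mathematical objects, no named facts. The
manifold-level repackaging for a metric on `U : Opens E` (through `OpensChart`) is a one-liner
left to the importing files.

## References

* B. O'Neill, *Semi-Riemannian geometry with applications to relativity*, Academic Press 1983,
  Ch. 9, Prop. 9.25, Lemma 9.28. [ONeill1983]
* S. Kobayashi, K. Nomizu, *Foundations of Differential Geometry* I, Wiley 1963, Ch. VI, Thm. 3.3.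
* R. M. Wald, *General Relativity*, University of Chicago Press 1984, App. C.3, (C.3.6)–(C.3.9).
  [Wald1984]
-/

noncomputable section

-- instance search through the nested operator types `E →L[ℝ] E →L[ℝ] E →L[ℝ] ℝ` (as in the tree files)
set_option maxSynthPendingDepth 3

open Set Filter Module Function Metric

open scoped ContDiff Topology

namespace Literature.Geometry.Lorentzian

namespace KillingJetRigidity

variable {E : Type*} [NormedAddCommGroup E] [NormedSpace ℝ E] [FiniteDimensional ℝ E]
  {G : E → E →L[ℝ] E →L[ℝ] ℝ} {X : E → E} {s : Set E}

/-! ### The braid identity for the coordinate Killing equation -/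

omit [FiniteDimensional ℝ E] in
/-- **The braid (Koszul) identity for the coordinate Killing equation.** Let `G` (symmetric forms)
and `X` be `C²` on the open set `s` and `𝓛_X G = 0` on `s`, i.e.
`DG_y(X y)(u, w) + G_y(DX_y u, w) + G_y(u, DX_y w) = 0`. Then at `x ∈ s`, for all `z, u, w`,
`2 G_x(D²X_x(z,u), w) = -(T(z;u,w) + T(u;z,w) - T(w;z,u))`,
`T(z;u,w) = D²G_x(z, X x)(u,w) + DG_x(DX_x z)(u,w) + DG_x(z)(DX_x u, w) + DG_x(z)(u, DX_x w)`
(Wald 1984, (C.3.6) `∇_a∇_b ξ_c = -R_{bcad} ξ^d`, read in coordinates). [cite: Wald1984, App. C.3 (C.3.6)] -/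
theorem two_mul_apply_fderiv_fderiv (hs : IsOpen s) (hG : ContDiffOn ℝ 2 G s) (hX : ContDiffOn ℝ 2 X s)
    (hsymm : ∀ y ∈ s, ∀ u w, G y u w = G y w u)
    (hK : ∀ y ∈ s, ∀ u w, fderiv ℝ G y (X y) u w + G y (fderiv ℝ X y u) w + G y u (fderiv ℝ X y w) = 0)
    {x : E} (hx : x ∈ s) (z u w : E) :
    2 * G x (fderiv ℝ (fderiv ℝ X) x z u) w =
      -((fderiv ℝ (fderiv ℝ G) x z (X x) u w + fderiv ℝ G x (fderiv ℝ X x z) u w +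
            fderiv ℝ G x z (fderiv ℝ X x u) w + fderiv ℝ G x z u (fderiv ℝ X x w)) +
          (fderiv ℝ (fderiv ℝ G) x u (X x) z w + fderiv ℝ G x (fderiv ℝ X x u) z w +
            fderiv ℝ G x u (fderiv ℝ X x z) w + fderiv ℝ G x u z (fderiv ℝ X x w)) -
          (fderiv ℝ (fderiv ℝ G) x w (X x) z u + fderiv ℝ G x (fderiv ℝ X x w) z u +
            fderiv ℝ G x w (fderiv ℝ X x z) u + fderiv ℝ G x w z (fderiv ℝ X x u))) := by
  set X' : E → E →L[ℝ] E := fderiv ℝ X with hX'_def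
  set X'' : E →L[ℝ] E →L[ℝ] E := fderiv ℝ X' x with hX''_def
  have hxs : s ∈ 𝓝 x := hs.mem_nhds hx
  have hXd : DifferentiableAt ℝ X x := (hX.differentiableOn two_ne_zero).differentiableAt hxs
  have hX'd : DifferentiableAt ℝ X' x :=
    ((hX.fderiv_of_isOpen hs (m := 1) (by norm_num)).differentiableOn one_ne_zero).differentiableAt hxs
  have hGd : DifferentiableAt ℝ G x := (hG.differentiableOn two_ne_zero).differentiableAt hxs
  have hG'd : DifferentiableAt ℝ (fderiv ℝ G) x :=
    ((hG.fderiv_of_isOpen hs (m := 1) (by norm_num)).differentiableOn one_ne_zero).differentiableAt hxs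
  have hsymm2 : ∀ v w, X'' v w = X'' w v := (hX.contDiffAt hxs).isSymmSndFDerivAt (by simp)
  have hsx : ∀ u w, G x u w = G x w u := hsymm x hx
  -- symmetry of `DG_x(z)` in the form slots
  have hsym1 : ∀ z u w, fderiv ℝ G x z u w = fderiv ℝ G x z w u := by
    intro z u w
    rw [← OpensChart.fderiv_apply₂ G hGd, ← OpensChart.fderiv_apply₂ G hGd]
    have heq : (fun y ↦ G y u w) =ᶠ[𝓝 x] fun y ↦ G y w u := by
      filter_upwards [hxs] with y hy
      exact hsymm y hy u w
    rw [heq.fderiv_eq]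
  -- differentiating the Killing equation along `z`
  have hT : ∀ z u w : E,
      fderiv ℝ (fderiv ℝ G) x z (X x) u w + fderiv ℝ G x (X' x z) u w +
        (fderiv ℝ G x z (X' x u) w + G x (X'' z u) w) +
        (fderiv ℝ G x z u (X' x w) + G x u (X'' z w)) = 0 := by
    intro z u w
    have hu : HasFDerivAt (fun y ↦ X' y u) (X''.flip u) x := by
      simpa using hX'd.hasFDerivAt.clm_apply (hasFDerivAt_const u x)
    have hw : HasFDerivAt (fun y ↦ X' y w) (X''.flip w) x := by
      simpa using hX'd.hasFDerivAt.clm_apply (hasFDerivAt_const w x)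
    -- `y ↦ DG_y (X y)`
    have h1 : HasFDerivAt (fun y ↦ fderiv ℝ G y (X y))
        ((fderiv ℝ G x).comp (X' x) + (fderiv ℝ (fderiv ℝ G) x).flip (X x)) x := by
      have h := hG'd.hasFDerivAt.clm_apply hXd.hasFDerivAt
      rwa [← hX'_def] at h
    have h1u : HasFDerivAt (fun y ↦ fderiv ℝ G y (X y) u)
        (((fderiv ℝ G x).comp (X' x) + (fderiv ℝ (fderiv ℝ G) x).flip (X x)).flip u) x := by
      simpa using h1.clm_apply (hasFDerivAt_const u x)
    have h1uw : HasFDerivAt (fun y ↦ fderiv ℝ G y (X y) u w)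
        ((((fderiv ℝ G x).comp (X' x) + (fderiv ℝ (fderiv ℝ G) x).flip (X x)).flip u).flip w) x := by
      simpa using h1u.clm_apply (hasFDerivAt_const w x)
    -- `y ↦ G y (X' y u) w`
    have h2 : HasFDerivAt (fun y ↦ G y (X' y u)) ((G x).comp (X''.flip u) + (fderiv ℝ G x).flip (X' x u)) x :=
      hGd.hasFDerivAt.clm_apply hu
    have h2w : HasFDerivAt (fun y ↦ G y (X' y u) w)
        (((G x).comp (X''.flip u) + (fderiv ℝ G x).flip (X' x u)).flip w) x := by
      simpa using h2.clm_apply (hasFDerivAt_const w x)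
    -- `y ↦ G y u (X' y w)`
    have h3 : HasFDerivAt (fun y ↦ G y u) ((fderiv ℝ G x).flip u) x := by
      simpa using hGd.hasFDerivAt.clm_apply (hasFDerivAt_const u x)
    have h3w : HasFDerivAt (fun y ↦ G y u (X' y w))
        ((G x u).comp (X''.flip w) + ((fderiv ℝ G x).flip u).flip (X' x w)) x :=
      h3.clm_apply hw
    have hsum := (h1uw.add h2w).add h3w
    have hzero : HasFDerivAt (fun y ↦ fderiv ℝ G y (X y) u w + G y (X' y u) w + G y u (X' y w))
        (0 : E →L[ℝ] ℝ) x := by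
      refine (hasFDerivAt_const (0 : ℝ) x).congr_of_eventuallyEq ?_
      filter_upwards [hxs] with y hy
      exact hK y hy u w
    have heq := hsum.unique hzero
    have hz := DFunLike.congr_fun heq z
    simp only [add_apply, ContinuousLinearMap.comp_apply,
      ContinuousLinearMap.flip_apply, zero_apply] at hz
    linarith
  have h1 := hT z u w
  have h2 := hT u z w
  have h3 := hT w z u
  rw [hsx u (X'' z w)] at h1
  rw [hsx z (X'' u w), hsymm2 u z] at h2
  rw [hsx z (X'' w u), hsymm2 w u, hsymm2 w z] at h3
  linarith

omit [FiniteDimensional ℝ E] in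
/-- **The braid identity at a zero of `X`**: if moreover `X x = 0`, the second derivatives of the
metric drop out and `2 G_x(D²X_x(z,u), w) = -(T₀(z;u,w) + T₀(u;z,w) - T₀(w;z,u))` with
`T₀(z;u,w) = DG_x(DX_x z)(u,w) + DG_x(z)(DX_x u, w) + DG_x(z)(u, DX_x w)` — the second-order data of
a Killing field at a zero is an explicit function of its first-order data and of the FIRST
derivatives of the metric. [cite: Wald1984, App. C.3 (C.3.6)] -/
theorem two_mul_apply_fderiv_fderiv_of_apply_eq_zero (hs : IsOpen s) (hG : ContDiffOn ℝ 2 G s)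
    (hX : ContDiffOn ℝ 2 X s) (hsymm : ∀ y ∈ s, ∀ u w, G y u w = G y w u)
    (hK : ∀ y ∈ s, ∀ u w, fderiv ℝ G y (X y) u w + G y (fderiv ℝ X y u) w + G y u (fderiv ℝ X y w) = 0)
    {x : E} (hx : x ∈ s) (h0 : X x = 0) (z u w : E) :
    2 * G x (fderiv ℝ (fderiv ℝ X) x z u) w =
      -((fderiv ℝ G x (fderiv ℝ X x z) u w + fderiv ℝ G x z (fderiv ℝ X x u) w +
            fderiv ℝ G x z u (fderiv ℝ X x w)) +
          (fderiv ℝ G x (fderiv ℝ X x u) z w + fderiv ℝ G x u (fderiv ℝ X x z) w +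
            fderiv ℝ G x u z (fderiv ℝ X x w)) -
          (fderiv ℝ G x (fderiv ℝ X x w) z u + fderiv ℝ G x w (fderiv ℝ X x z) u +
            fderiv ℝ G x w z (fderiv ℝ X x u))) := by
  have h := two_mul_apply_fderiv_fderiv hs hG hX hsymm hK hx z u w
  simp only [h0, map_zero, zero_apply, zero_add] at h
  exact h

/-! ### Prolongation bound: `‖D²X‖ ≤ C (‖X‖ + ‖DX‖)` near a nondegenerate point -/

omit [FiniteDimensional ℝ E] in
/-- `|T(z, u, w)| ≤ ‖T‖ ‖z‖ ‖u‖ ‖w‖` for a trilinear form given as iterated operators (local copy of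
`MetricCoord.norm_apply₃_le` of `CoordLaplacianPerturbation.lean`, kept private to keep this file's
import cone Mathlib-level). [folklore] -/
private theorem norm_apply₃_le (T : E →L[ℝ] E →L[ℝ] E →L[ℝ] ℝ) (z u w : E) :
    ‖T z u w‖ ≤ ‖T‖ * ‖z‖ * ‖u‖ * ‖w‖ :=
  calc ‖T z u w‖ ≤ ‖T z u‖ * ‖w‖ := (T z u).le_opNorm w
    _ ≤ ‖T z‖ * ‖u‖ * ‖w‖ := by gcongr; exact (T z).le_opNorm u
    _ ≤ ‖T‖ * ‖z‖ * ‖u‖ * ‖w‖ := by gcongr; exact T.le_opNorm z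

omit [FiniteDimensional ℝ E] in
/-- `|T(y, z, u, w)| ≤ ‖T‖ ‖y‖ ‖z‖ ‖u‖ ‖w‖` for a quadrilinear form given as iterated operators.
[folklore] -/
private theorem norm_apply₄_le (T : E →L[ℝ] E →L[ℝ] E →L[ℝ] E →L[ℝ] ℝ) (y z u w : E) :
    ‖T y z u w‖ ≤ ‖T‖ * ‖y‖ * ‖z‖ * ‖u‖ * ‖w‖ :=
  calc ‖T y z u w‖ ≤ ‖T y‖ * ‖z‖ * ‖u‖ * ‖w‖ := norm_apply₃_le (T y) z u w
    _ ≤ ‖T‖ * ‖y‖ * ‖z‖ * ‖u‖ * ‖w‖ := by gcongr; exact T.le_opNorm y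

/-- **Uniform nondegeneracy near a nondegenerate point**: if `G_{x₀}` is nondegenerate and `G` is
continuous at `x₀`, there are `c > 0` and a neighbourhood `U` of `x₀` with `‖y‖ ≤ c ‖G_x y‖` for all
`x ∈ U`, `y ∈ E` (`G_{x₀} : E → E*` is a linear isomorphism, and isomorphisms are stable). [folklore] -/
theorem exists_norm_le_mul_norm_apply {x₀ : E} (hGc : ContinuousAt G x₀)
    (hnd : ∀ u, (∀ w, G x₀ u w = 0) → u = 0) :
    ∃ c > (0 : ℝ), ∀ᶠ x in 𝓝 x₀, ∀ y : E, ‖y‖ ≤ c * ‖G x y‖ := by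
  have hinj : Injective (G x₀) := by
    refine (injective_iff_map_eq_zero _).2 fun u hu ↦ hnd u fun w ↦ ?_
    rw [hu, zero_apply]
  have hbij : Bijective (G x₀) :=
    ⟨hinj, (LinearMap.injective_iff_surjective_of_finrank_eq_finrank
      (f := (G x₀ : E →ₗ[ℝ] E →L[ℝ] ℝ)) JetRigidity.finrank_dual_clm.symm).1 hinj⟩
  obtain ⟨e, he⟩ := JetRigidity.isInvertible_of_bijective hbij
  set k : ℝ := ‖(e.symm : (E →L[ℝ] ℝ) →L[ℝ] E)‖ with hk
  have hk0 : 0 ≤ k := norm_nonneg _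
  have hle : ∀ y : E, ‖y‖ ≤ k * ‖G x₀ y‖ := fun y ↦ by
    have h := (e.symm : (E →L[ℝ] ℝ) →L[ℝ] E).le_opNorm (e y)
    rw [ContinuousLinearEquiv.coe_coe, e.symm_apply_apply] at h
    rwa [← he] 
  refine ⟨2 * k + 2, by positivity, ?_⟩
  have hε : ∀ᶠ x in 𝓝 x₀, ‖G x - G x₀‖ ≤ 1 / (2 * k + 2) := by
    have h := Metric.continuousAt_iff'.1 hGc (1 / (2 * k + 2)) (by positivity)
    filter_upwards [h] with x hx
    rw [dist_eq_norm] at hx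
    exact hx.le
  filter_upwards [hε] with x hx y
  have h1 := hle y
  have h2 : ‖G x₀ y‖ ≤ ‖G x y‖ + ‖(G x - G x₀) y‖ := by
    have : G x₀ y = G x y - (G x - G x₀) y := by simp
    rw [this]
    exact norm_sub_le _ _
  have h3 : ‖(G x - G x₀) y‖ ≤ 1 / (2 * k + 2) * ‖y‖ :=
    (ContinuousLinearMap.le_opNorm _ _).trans (mul_le_mul_of_nonneg_right hx (norm_nonneg _))
  have h4 : ‖y‖ ≤ k * ‖G x y‖ + k * (1 / (2 * k + 2) * ‖y‖) :=
    calc ‖y‖ ≤ k * ‖G x₀ y‖ := h1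
      _ ≤ k * (‖G x y‖ + ‖(G x - G x₀) y‖) := by gcongr
      _ ≤ k * (‖G x y‖ + 1 / (2 * k + 2) * ‖y‖) := by gcongr
      _ = k * ‖G x y‖ + k * (1 / (2 * k + 2) * ‖y‖) := by ring
  have h5 : k * (1 / (2 * k + 2)) ≤ 1 / 2 := by
    rw [← mul_div_assoc, mul_one, div_le_iff₀ (by positivity)]; linarith
  have h6 : k * (1 / (2 * k + 2) * ‖y‖) ≤ 1 / 2 * ‖y‖ := by
    rw [← mul_assoc]; exact mul_le_mul_of_nonneg_right h5 (norm_nonneg y)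
  have h7 : ‖y‖ ≤ 2 * k * ‖G x y‖ := by linarith
  calc ‖y‖ ≤ 2 * k * ‖G x y‖ := h7
    _ ≤ (2 * k + 2) * ‖G x y‖ := by gcongr; linarith


omit [FiniteDimensional ℝ E] in
/-- Elementary: `|a|, |b|, |c| ≤ K` give `|-(a + b - c)| ≤ 3K`. [folklore] -/
theorem abs_neg_add_sub_le_three {a b c K : ℝ} (ha : |a| ≤ K) (hb : |b| ≤ K) (hc : |c| ≤ K) :
    |-(a + b - c)| ≤ 3 * K := by
  rw [abs_neg]
  calc |a + b - c| ≤ |a + b| + |c| := abs_sub _ _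
    _ ≤ |a| + |b| + |c| := by linarith [abs_add_le a b]
    _ ≤ 3 * K := by linarith

-- the quadruply iterated operator space of `D²G` needs one more level of pending instance synthesis,
-- and the operator-norm estimates through it are slow to unify at that depth
set_option maxSynthPendingDepth 4 in
set_option maxHeartbeats 800000 in
/-- **Prolongation bound.** For `G` (symmetric forms) and `X` of class `C²` on the open set `s`
with `𝓛_X G = 0`, near every point `x₀ ∈ s` at which `G` is nondegenerate there is a constant `C`
with `‖D²X_x‖ ≤ C (‖X x‖ + ‖DX_x‖)` (solve the braid identity for `D²X` through the uniformly
invertible pairing `G_x`). O'Neill 1983, Ch. 9, proof of Lemma 9.28. [cite: ONeill1983, Ch. 9, Lemma 9.28] -/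
theorem exists_norm_fderiv_fderiv_le (hs : IsOpen s) (hG : ContDiffOn ℝ 2 G s) (hX : ContDiffOn ℝ 2 X s)
    (hsymm : ∀ y ∈ s, ∀ u w, G y u w = G y w u)
    (hK : ∀ y ∈ s, ∀ u w, fderiv ℝ G y (X y) u w + G y (fderiv ℝ X y u) w + G y u (fderiv ℝ X y w) = 0)
    {x₀ : E} (hx₀ : x₀ ∈ s) (hnd : ∀ u, (∀ w, G x₀ u w = 0) → u = 0) :
    ∃ C : ℝ, ∀ᶠ x in 𝓝 x₀, ‖fderiv ℝ (fderiv ℝ X) x‖ ≤ C * (‖X x‖ + ‖fderiv ℝ X x‖) := by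
  have hxs : s ∈ 𝓝 x₀ := hs.mem_nhds hx₀
  have hGc : ContinuousAt G x₀ := (hG.continuousOn.continuousWithinAt hx₀).continuousAt hxs
  obtain ⟨c, hc, hcU⟩ := exists_norm_le_mul_norm_apply hGc hnd
  -- local bounds for `DG`, `D²G`
  have hG1 : ContDiffOn ℝ 1 (fderiv ℝ G) s := hG.fderiv_of_isOpen hs (m := 1) (by norm_num)
  have hG'c : ContinuousAt (fderiv ℝ G) x₀ := (hG1.continuousOn.continuousWithinAt hx₀).continuousAt hxs
  have hG''c : ContinuousAt (fderiv ℝ (fderiv ℝ G)) x₀ :=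
    ((hG1.continuousOn_fderiv_of_isOpen hs le_rfl).continuousWithinAt hx₀).continuousAt hxs
  set A : ℝ := ‖fderiv ℝ G x₀‖ + 1 with hA
  set B : ℝ := ‖fderiv ℝ (fderiv ℝ G) x₀‖ + 1 with hB
  have hA' : ∀ᶠ x in 𝓝 x₀, ‖fderiv ℝ G x‖ ≤ A := by
    have h := Metric.continuousAt_iff'.1 hG'c 1 one_pos
    filter_upwards [h] with x hx
    rw [dist_eq_norm] at hx
    have := norm_le_insert' (fderiv ℝ G x) (fderiv ℝ G x₀)
    linarith
  have hB' : ∀ᶠ x in 𝓝 x₀, ‖fderiv ℝ (fderiv ℝ G) x‖ ≤ B := by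
    have h := Metric.continuousAt_iff'.1 hG''c 1 one_pos
    filter_upwards [h] with x hx
    rw [dist_eq_norm] at hx
    have := norm_le_insert' (fderiv ℝ (fderiv ℝ G) x) (fderiv ℝ (fderiv ℝ G) x₀)
    linarith
  refine ⟨c * (3 * (B + 3 * A)) / 2, ?_⟩
  filter_upwards [hcU, hA', hB', hxs] with x hcx hAx hBx hx
  have hA0 : 0 ≤ A := by positivity
  have hB0 : 0 ≤ B := by positivity
  set N : ℝ := ‖X x‖ + ‖fderiv ℝ X x‖ with hN
  have hN0 : 0 ≤ N := by positivity
  -- the scalar bound on `2 G_x(D²X(z,u), w)`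
  have hXle : ‖X x‖ ≤ N := by rw [hN]; linarith [norm_nonneg (fderiv ℝ X x)]
  have hDle : ‖fderiv ℝ X x‖ ≤ N := by rw [hN]; linarith [norm_nonneg (X x)]
  have hT : ∀ z u w : E,
      |fderiv ℝ (fderiv ℝ G) x z (X x) u w + fderiv ℝ G x (fderiv ℝ X x z) u w +
          fderiv ℝ G x z (fderiv ℝ X x u) w + fderiv ℝ G x z u (fderiv ℝ X x w)| ≤
        (B + 3 * A) * N * (‖z‖ * ‖u‖ * ‖w‖) := by
    intro z u w
    have hzuw : 0 ≤ ‖z‖ * ‖u‖ * ‖w‖ := by positivity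
    have e1 : |fderiv ℝ (fderiv ℝ G) x z (X x) u w| ≤ B * N * (‖z‖ * ‖u‖ * ‖w‖) := by
      rw [← Real.norm_eq_abs]
      calc ‖fderiv ℝ (fderiv ℝ G) x z (X x) u w‖
          ≤ ‖fderiv ℝ (fderiv ℝ G) x‖ * ‖z‖ * ‖X x‖ * ‖u‖ * ‖w‖ := norm_apply₄_le _ z (X x) u w
        _ ≤ B * ‖z‖ * N * ‖u‖ * ‖w‖ := by gcongr
        _ = B * N * (‖z‖ * ‖u‖ * ‖w‖) := by ring
    have e2 : |fderiv ℝ G x (fderiv ℝ X x z) u w| ≤ A * N * (‖z‖ * ‖u‖ * ‖w‖) := by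
      rw [← Real.norm_eq_abs]
      calc ‖fderiv ℝ G x (fderiv ℝ X x z) u w‖
          ≤ ‖fderiv ℝ G x‖ * ‖fderiv ℝ X x z‖ * ‖u‖ * ‖w‖ := norm_apply₃_le _ _ u w
        _ ≤ ‖fderiv ℝ G x‖ * (‖fderiv ℝ X x‖ * ‖z‖) * ‖u‖ * ‖w‖ := by
            gcongr; exact ContinuousLinearMap.le_opNorm _ _
        _ ≤ A * (N * ‖z‖) * ‖u‖ * ‖w‖ := by gcongr
        _ = A * N * (‖z‖ * ‖u‖ * ‖w‖) := by ring
    have e3 : |fderiv ℝ G x z (fderiv ℝ X x u) w| ≤ A * N * (‖z‖ * ‖u‖ * ‖w‖) := by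
      rw [← Real.norm_eq_abs]
      calc ‖fderiv ℝ G x z (fderiv ℝ X x u) w‖
          ≤ ‖fderiv ℝ G x‖ * ‖z‖ * ‖fderiv ℝ X x u‖ * ‖w‖ := norm_apply₃_le _ z _ w
        _ ≤ ‖fderiv ℝ G x‖ * ‖z‖ * (‖fderiv ℝ X x‖ * ‖u‖) * ‖w‖ := by
            gcongr; exact ContinuousLinearMap.le_opNorm _ _
        _ ≤ A * ‖z‖ * (N * ‖u‖) * ‖w‖ := by gcongr
        _ = A * N * (‖z‖ * ‖u‖ * ‖w‖) := by ring
    have e4 : |fderiv ℝ G x z u (fderiv ℝ X x w)| ≤ A * N * (‖z‖ * ‖u‖ * ‖w‖) := by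
      rw [← Real.norm_eq_abs]
      calc ‖fderiv ℝ G x z u (fderiv ℝ X x w)‖
          ≤ ‖fderiv ℝ G x‖ * ‖z‖ * ‖u‖ * ‖fderiv ℝ X x w‖ := norm_apply₃_le _ z u _
        _ ≤ ‖fderiv ℝ G x‖ * ‖z‖ * ‖u‖ * (‖fderiv ℝ X x‖ * ‖w‖) := by
            gcongr; exact ContinuousLinearMap.le_opNorm _ _
        _ ≤ A * ‖z‖ * ‖u‖ * (N * ‖w‖) := by gcongr
        _ = A * N * (‖z‖ * ‖u‖ * ‖w‖) := by ring
    calc |fderiv ℝ (fderiv ℝ G) x z (X x) u w + fderiv ℝ G x (fderiv ℝ X x z) u w +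
            fderiv ℝ G x z (fderiv ℝ X x u) w + fderiv ℝ G x z u (fderiv ℝ X x w)|
        ≤ B * N * (‖z‖ * ‖u‖ * ‖w‖) + A * N * (‖z‖ * ‖u‖ * ‖w‖) +
            A * N * (‖z‖ * ‖u‖ * ‖w‖) + A * N * (‖z‖ * ‖u‖ * ‖w‖) :=
          (abs_add_le _ _).trans (add_le_add ((abs_add_le _ _).trans (add_le_add
            ((abs_add_le _ _).trans (add_le_add e1 e2)) e3)) e4)
      _ = (B + 3 * A) * N * (‖z‖ * ‖u‖ * ‖w‖) := by ring
  -- the bound on the functional `w ↦ G_x(D²X(z,u), w)`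
  have hfun : ∀ z u : E, ‖G x (fderiv ℝ (fderiv ℝ X) x z u)‖ ≤
      3 * (B + 3 * A) * N / 2 * (‖z‖ * ‖u‖) := by
    intro z u
    refine ContinuousLinearMap.opNorm_le_bound _ (by positivity) fun w ↦ ?_
    have h := two_mul_apply_fderiv_fderiv hs hG hX hsymm hK hx z u w
    have t1 := hT z u w
    have t2 := hT u z w
    have t3 := hT w z u
    rw [show ‖u‖ * ‖z‖ * ‖w‖ = ‖z‖ * ‖u‖ * ‖w‖ by ring] at t2
    rw [show ‖w‖ * ‖z‖ * ‖u‖ = ‖z‖ * ‖u‖ * ‖w‖ by ring] at t3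
    have habs : |2 * G x (fderiv ℝ (fderiv ℝ X) x z u) w| ≤
        3 * ((B + 3 * A) * N * (‖z‖ * ‖u‖ * ‖w‖)) := by
      rw [h]
      exact abs_neg_add_sub_le_three t1 t2 t3
    rw [abs_mul, abs_two] at habs
    rw [Real.norm_eq_abs]
    calc |G x (fderiv ℝ (fderiv ℝ X) x z u) w| ≤ 3 * ((B + 3 * A) * N * (‖z‖ * ‖u‖ * ‖w‖)) / 2 := by
          linarith
      _ = 3 * (B + 3 * A) * N / 2 * (‖z‖ * ‖u‖) * ‖w‖ := by ring
  -- invert `G_x`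
  have hvec : ∀ z u : E, ‖fderiv ℝ (fderiv ℝ X) x z u‖ ≤ c * (3 * (B + 3 * A) * N / 2) * (‖z‖ * ‖u‖) := by
    intro z u
    calc ‖fderiv ℝ (fderiv ℝ X) x z u‖ ≤ c * ‖G x (fderiv ℝ (fderiv ℝ X) x z u)‖ := hcx _
      _ ≤ c * (3 * (B + 3 * A) * N / 2 * (‖z‖ * ‖u‖)) := by gcongr; exact hfun z u
      _ = c * (3 * (B + 3 * A) * N / 2) * (‖z‖ * ‖u‖) := by ring
  have hop : ‖fderiv ℝ (fderiv ℝ X) x‖ ≤ c * (3 * (B + 3 * A) * N / 2) := by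
    refine ContinuousLinearMap.opNorm_le_bound _ (by positivity) fun z ↦ ?_
    refine ContinuousLinearMap.opNorm_le_bound _ (by positivity) fun u ↦ ?_
    calc ‖fderiv ℝ (fderiv ℝ X) x z u‖ ≤ c * (3 * (B + 3 * A) * N / 2) * (‖z‖ * ‖u‖) := hvec z u
      _ = c * (3 * (B + 3 * A) * N / 2) * ‖z‖ * ‖u‖ := by ring
  calc ‖fderiv ℝ (fderiv ℝ X) x‖ ≤ c * (3 * (B + 3 * A) * N / 2) := hop
    _ = c * (3 * (B + 3 * A)) / 2 * N := by ring

/-! ### Grönwall along segments: vanishing of the 1-jet propagates -/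

/-- **Local propagation of a vanishing 1-jet.** For `G` (symmetric forms) and `X` of class `C²` on
the open set `s` with `𝓛_X G = 0`: if `G_{x₀}` is nondegenerate and `X x₀ = 0`, `DX_{x₀} = 0`, then
`X = 0` and `DX = 0` on a neighbourhood of `x₀` (the 1-jet `t ↦ (X, DX)(x₀ + t v)` solves a linear
ODE `|y'| ≤ K |y|` along every short segment, so Grönwall's inequality forces it to vanish).
O'Neill 1983, Ch. 9, Lemma 9.28; Kobayashi–Nomizu I, Ch. VI, Thm. 3.3. [cite: ONeill1983, Ch. 9, Lemma 9.28] -/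
theorem eventually_eq_zero_of_oneJet_eq_zero (hs : IsOpen s) (hG : ContDiffOn ℝ 2 G s)
    (hX : ContDiffOn ℝ 2 X s) (hsymm : ∀ y ∈ s, ∀ u w, G y u w = G y w u)
    (hK : ∀ y ∈ s, ∀ u w, fderiv ℝ G y (X y) u w + G y (fderiv ℝ X y u) w + G y u (fderiv ℝ X y w) = 0)
    {x₀ : E} (hx₀ : x₀ ∈ s) (hnd : ∀ u, (∀ w, G x₀ u w = 0) → u = 0)
    (h0 : X x₀ = 0) (h1 : fderiv ℝ X x₀ = 0) :
    ∀ᶠ x in 𝓝 x₀, X x = 0 ∧ fderiv ℝ X x = 0 := by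
  obtain ⟨C, hC⟩ := exists_norm_fderiv_fderiv_le hs hG hX hsymm hK hx₀ hnd
  obtain ⟨ρ, hρ, hball⟩ : ∃ ρ > 0, ball x₀ ρ ⊆ {x | ‖fderiv ℝ (fderiv ℝ X) x‖ ≤ C * (‖X x‖ + ‖fderiv ℝ X x‖)} ∩ s :=
    Metric.mem_nhds_iff.1 (Filter.inter_mem hC (hs.mem_nhds hx₀))
  have hC0 : 0 ≤ C ∨ ∀ x ∈ ball x₀ ρ, X x = 0 ∧ fderiv ℝ X x = 0 := by
    by_cases hC0 : 0 ≤ C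
    · exact Or.inl hC0
    · refine Or.inr fun x hx ↦ ?_
      have h := (hball hx).1
      simp only [mem_setOf_eq] at h
      have hn : ‖X x‖ + ‖fderiv ℝ X x‖ = 0 := by
        by_contra hne
        have hpos : 0 < ‖X x‖ + ‖fderiv ℝ X x‖ := lt_of_le_of_ne (by positivity) (Ne.symm hne)
        have : C * (‖X x‖ + ‖fderiv ℝ X x‖) < 0 := mul_neg_of_neg_of_pos (lt_of_not_ge hC0) hpos
        linarith [norm_nonneg (fderiv ℝ (fderiv ℝ X) x)]
      constructor
      · exact norm_eq_zero.1 (by linarith [norm_nonneg (X x), norm_nonneg (fderiv ℝ X x)])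
      · exact norm_eq_zero.1 (by linarith [norm_nonneg (X x), norm_nonneg (fderiv ℝ X x)])
  rcases hC0 with hC0 | htriv
  swap
  · exact Filter.eventually_of_mem (ball_mem_nhds x₀ hρ) htriv
  refine Filter.eventually_of_mem (ball_mem_nhds x₀ hρ) fun x hx ↦ ?_
  -- the segment from `x₀` to `x` and the 1-jet along it
  set v : E := x - x₀ with hv
  let γ : ℝ → E := fun t ↦ x₀ + t • v
  have hγd : ∀ t, HasDerivAt γ v t := fun t ↦ by
    have h := ((hasDerivAt_id t).smul_const v).const_add x₀
    rwa [one_smul] at h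
  have hγball : ∀ t ∈ Icc (0 : ℝ) 1, γ t ∈ ball x₀ ρ := by
    intro t ht
    rw [mem_ball, dist_eq_norm]
    have hxv : ‖v‖ < ρ := by rwa [hv, ← dist_eq_norm, ← mem_ball]
    calc ‖γ t - x₀‖ = ‖t • v‖ := by simp [γ]
      _ = |t| * ‖v‖ := norm_smul t v
      _ ≤ 1 * ‖v‖ := by gcongr; rw [abs_le]; constructor <;> linarith [ht.1, ht.2]
      _ < ρ := by rwa [one_mul]
  let Y : ℝ → E × (E →L[ℝ] E) := fun t ↦ (X (γ t), fderiv ℝ X (γ t))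
  let Y' : ℝ → E × (E →L[ℝ] E) := fun t ↦ (fderiv ℝ X (γ t) v, fderiv ℝ (fderiv ℝ X) (γ t) v)
  have hY : ∀ t ∈ Icc (0 : ℝ) 1, HasDerivAt Y (Y' t) t := by
    intro t ht
    have hts : s ∈ 𝓝 (γ t) := hs.mem_nhds (hball (hγball t ht)).2
    have h1 : HasDerivAt (fun t ↦ X (γ t)) (fderiv ℝ X (γ t) v) t :=
      ((hX.differentiableOn two_ne_zero).differentiableAt hts).hasFDerivAt.comp_hasDerivAt t (hγd t)
    have h2 : HasDerivAt (fun t ↦ fderiv ℝ X (γ t)) (fderiv ℝ (fderiv ℝ X) (γ t) v) t :=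
      (((hX.fderiv_of_isOpen hs (m := 1) (by norm_num)).differentiableOn
        one_ne_zero).differentiableAt hts).hasFDerivAt.comp_hasDerivAt t (hγd t)
    exact h1.prodMk h2
  have hYc : ContinuousOn Y (Icc 0 1) := fun t ht ↦ (hY t ht).continuousAt.continuousWithinAt
  have hbound : ∀ t ∈ Ico (0 : ℝ) 1, ‖Y' t‖ ≤ (1 + 2 * C) * ‖v‖ * ‖Y t‖ + 0 := by
    intro t ht
    have ht' : t ∈ Icc (0 : ℝ) 1 := ⟨ht.1, ht.2.le⟩
    have hb := (hball (hγball t ht')).1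
    simp only [mem_setOf_eq] at hb
    have n1 : ‖X (γ t)‖ ≤ ‖Y t‖ := norm_fst_le (Y t)
    have n2 : ‖fderiv ℝ X (γ t)‖ ≤ ‖Y t‖ := norm_snd_le (Y t)
    have hvY : 0 ≤ ‖v‖ * ‖Y t‖ := by positivity
    rw [add_zero, Prod.norm_def]
    refine max_le ?_ ?_
    · calc ‖fderiv ℝ X (γ t) v‖ ≤ ‖fderiv ℝ X (γ t)‖ * ‖v‖ := ContinuousLinearMap.le_opNorm _ _
        _ ≤ ‖Y t‖ * ‖v‖ := by gcongr
        _ = 1 * (‖v‖ * ‖Y t‖) := by ring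
        _ ≤ (1 + 2 * C) * (‖v‖ * ‖Y t‖) := by gcongr; linarith
        _ = (1 + 2 * C) * ‖v‖ * ‖Y t‖ := by ring
    · calc ‖fderiv ℝ (fderiv ℝ X) (γ t) v‖ ≤ ‖fderiv ℝ (fderiv ℝ X) (γ t)‖ * ‖v‖ :=
            ContinuousLinearMap.le_opNorm _ _
        _ ≤ C * (‖X (γ t)‖ + ‖fderiv ℝ X (γ t)‖) * ‖v‖ := by gcongr
        _ ≤ C * (‖Y t‖ + ‖Y t‖) * ‖v‖ := by gcongr
        _ = 2 * C * (‖v‖ * ‖Y t‖) := by ring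
        _ ≤ (1 + 2 * C) * (‖v‖ * ‖Y t‖) := by gcongr; linarith
        _ = (1 + 2 * C) * ‖v‖ * ‖Y t‖ := by ring
  have hY0 : ‖Y 0‖ ≤ 0 := by simp [Y, γ, h0, h1]
  have hgr := norm_le_gronwallBound_of_norm_deriv_right_le hYc
    (fun t ht ↦ (hY t ⟨ht.1, ht.2.le⟩).hasDerivWithinAt) hY0 hbound 1 ⟨zero_le_one, le_rfl⟩
  rw [gronwallBound_ε0_δ0] at hgr
  have hY1 : Y 1 = 0 := norm_le_zero_iff.1 hgr
  have hγ1 : γ 1 = x := by simp [γ, hv]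
  simp only [Y, hγ1, Prod.mk_eq_zero] at hY1
  exact hY1

/-- **Chart-level one-jet rigidity of Killing fields.** Let `s ⊆ E` be open and preconnected, `G`
a `C²` field of symmetric nondegenerate forms on `s` and `X` a `C²` solution of the coordinate
Killing equation `𝓛_X G = 0` on `s`. If `X x₀ = 0` and `DX_{x₀} = 0` at one point `x₀ ∈ s`, then
`X = 0` and `DX = 0` on all of `s` (the vanishing set of the 1-jet is open by
`eventually_eq_zero_of_oneJet_eq_zero` and relatively closed by continuity). O'Neill 1983, Ch. 9,
Lemma 9.28 (without completeness); Kobayashi–Nomizu I, Ch. VI, Thm. 3.3; Wald 1984, App. C.3.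
[cite: ONeill1983, Ch. 9, Lemma 9.28] -/
theorem eqOn_zero_of_isPreconnected (hs : IsOpen s) (hconn : IsPreconnected s)
    (hG : ContDiffOn ℝ 2 G s) (hX : ContDiffOn ℝ 2 X s) (hsymm : ∀ y ∈ s, ∀ u w, G y u w = G y w u)
    (hnd : ∀ y ∈ s, ∀ u, (∀ w, G y u w = 0) → u = 0)
    (hK : ∀ y ∈ s, ∀ u w, fderiv ℝ G y (X y) u w + G y (fderiv ℝ X y u) w + G y u (fderiv ℝ X y w) = 0)
    {x₀ : E} (hx₀ : x₀ ∈ s) (h0 : X x₀ = 0) (h1 : fderiv ℝ X x₀ = 0) :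
    ∀ x ∈ s, X x = 0 ∧ fderiv ℝ X x = 0 := by
  let Z : Set E := {x | ∀ᶠ y in 𝓝 x, X y = 0 ∧ fderiv ℝ X y = 0}
  have hZo : IsOpen Z := isOpen_setOf_eventually_nhds
  have hZ0 : x₀ ∈ Z := eventually_eq_zero_of_oneJet_eq_zero hs hG hX hsymm hK hx₀ (hnd x₀ hx₀) h0 h1
  have hXc : ContinuousOn X s := hX.continuousOn
  have hX'c : ContinuousOn (fderiv ℝ X) s := hX.continuousOn_fderiv_of_isOpen hs (by norm_num)
  have hsub : s ⊆ Z := by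
    refine hconn.subset_of_closure_inter_subset hZo ⟨x₀, hx₀, hZ0⟩ ?_
    rintro x ⟨hxc, hx⟩
    have hxs : s ∈ 𝓝 x := hs.mem_nhds hx
    -- the 1-jet vanishes at `x` by continuity
    have hfr : ∃ᶠ y in 𝓝 x, X y = 0 ∧ fderiv ℝ X y = 0 := by
      rw [mem_closure_iff_frequently] at hxc
      exact hxc.mono fun y hy ↦ hy.self_of_nhds
    have hXx : X x = 0 :=
      tendsto_nhds_unique_of_frequently_eq ((hXc.continuousWithinAt hx).continuousAt hxs)
        tendsto_const_nhds (hfr.mono fun y hy ↦ hy.1)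
    have hX'x : fderiv ℝ X x = 0 :=
      tendsto_nhds_unique_of_frequently_eq ((hX'c.continuousWithinAt hx).continuousAt hxs)
        tendsto_const_nhds (hfr.mono fun y hy ↦ hy.2)
    exact eventually_eq_zero_of_oneJet_eq_zero hs hG hX hsymm hK hx (hnd x hx) hXx hX'x
  intro x hx
  exact (hsub hx).self_of_nhds

end KillingJetRigidity

end Literature.Geometry.Lorentzian

end
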